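import Literature.Algebra.Homology.TotalQuasiIsoOfColumns
import HarnessLib

/-!
# A cochain complex as a one-column bicomplex, and the isomorphism `X ≅ Tot(X[0])` (Weibel 1.2.6; Stacks 012Z)

Layer `Literature/Algebra/Homology` (constructions + proved lemmas; 0 named facts, no instance, no notation; pure homological
algebra in an abelian category `C` with the total complexes of `ℤ × ℤ`-bicomplexes). Companion of `Algebra/Homology/BicomplexSingleRow`
for the OTHER direction: a cochain complex `X` is viewed as the bicomplex `X[0]` with ONE COLUMN, the complex `X` in outer degree
`0` (Mathlib's `single (CochainComplex C ℤ) (up ℤ) 0`; outer differential `0`, inner differential `d_X`):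

* `singleColumnFunctor C`, `singleColumnBicomplex X = (singleColumnFunctor C).obj X`, the vanishing off the column `q = 0`
  (`isZero_singleColumnBicomplex_X(_X)`) and the amplitude lemmas `isStrictlyGE/LE_singleColumnBicomplex(_X)`;
* `ιTotalSingleColumnF X n : Xⁿ ⟶ Tot(X[0])ⁿ` (the summand `(0, n)`), an isomorphism (`TotalQuasiIsoOfColumns.isIso_ιTotal_of_isZero`);
* **`ιTotalSingleColumn X : X ⟶ (singleColumnBicomplex X).total (up ℤ)`** — a chain map (the sign of Mathlib's total differential
  on the vertical part of the summand `(0, n)` is `ε₂(0, n) = ε(0) = 1`) and an ISOMORPHISM (`isIso_ιTotalSingleColumn`,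
  `ιTotalSingleColumnIso`), natural in `X` (`ιTotalSingleColumn_naturality`).

The tree's `TotalQuasiIsoOfColumns.quasiIso_total_map_single_map_zero_iff` builds these maps inline (proof-local) and exposes only
«`Tot(ψ[0])` is a quasi-isomorphism iff `ψ` is»; here they are named (for the horizontal augmentations of bicomplexes of total
complexes), that theorem is cited and not re-proved. Library only (cell `pub-hodge-ring2`, count-neutral); proves nothing about
any crux, route or conjecture. Mathlib searched (pin v4.32): `HomologicalComplex.single`, `singleObjXSelf`, `single_obj_d`,
`single_map_f_self`, `isZero_single_obj_X`, `HomologicalComplex₂.ιTotal` / `total_d` / `ι_D₁` / `ι_D₂` / `d₁_eq'` / `d₂_eq` /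
`ιTotal_map`, `ComplexShape.ε_zero`, `Hom.isIso_of_components` (used).

## References

* C. A. Weibel, *An introduction to homological algebra* (1994), 1.2.6 and Ex. 1.2.8 (total complex; a complex as a double
  complex concentrated in one column). [Weibel1994]
* The Stacks Project, Tag 012Z (total complex and its signs). [StacksProject]
-/

noncomputable section

-- `GradedObject`/`HomologicalComplex₂.toGradedObject` are not reducible (as in Mathlib's `Algebra/Homology/TotalComplex.lean`).
set_option backward.isDefEq.respectTransparency false

open CategoryTheory CategoryTheory.Category CategoryTheory.Limits HomologicalComplex

universe v u

namespace Literature.Algebra.Homology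

variable {C : Type u} [Category.{v} C] [Abelian C]

/-! ### §1 The one-column bicomplex `X[0]` -/

variable (C) in
/-- **`X ↦ X[0]`**: a cochain complex as a bicomplex with one column, the complex `X` in outer degree `0`, functorially in `X`
(Mathlib's `single (CochainComplex C ℤ) (up ℤ) 0`). [cite: Weibel1994, 1.2.6 and Ex. 1.2.8] -/
abbrev singleColumnFunctor : CochainComplex C ℤ ⥤ HomologicalComplex₂ C (ComplexShape.up ℤ) (ComplexShape.up ℤ) :=
  single (CochainComplex C ℤ) (ComplexShape.up ℤ) 0

/-- The one-column bicomplex `X[0]` of a cochain complex `X`. [cite: Weibel1994, 1.2.6 and Ex. 1.2.8] -/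
abbrev singleColumnBicomplex (X : CochainComplex C ℤ) : HomologicalComplex₂ C (ComplexShape.up ℤ) (ComplexShape.up ℤ) :=
  (singleColumnFunctor C).obj X

variable (X : CochainComplex C ℤ)

/-- The column `0` of `X[0]` is `X` (Mathlib's `singleObjXSelf`). [cite: Weibel1994, 1.2.6] -/
def singleColumnBicomplexXZeroIso : (singleColumnBicomplex X).X 0 ≅ X :=
  singleObjXSelf (ComplexShape.up ℤ) 0 X

/-- The columns `q ≠ 0` of `X[0]` are zero complexes. [cite: Weibel1994, 1.2.6] -/
theorem isZero_singleColumnBicomplex_X (q : ℤ) (hq : q ≠ 0) : IsZero ((singleColumnBicomplex X).X q) :=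
  isZero_single_obj_X _ _ _ _ hq

/-- The entries of `X[0]` off the column `q = 0` vanish. [cite: Weibel1994, 1.2.6] -/
theorem isZero_singleColumnBicomplex_X_X (q : ℤ) (hq : q ≠ 0) (n : ℤ) : IsZero (((singleColumnBicomplex X).X q).X n) :=
  isZero_single_obj_X_X X 0 hq n

/-- The outer differentials of `X[0]` vanish. [cite: Weibel1994, 1.2.6] -/
theorem singleColumnBicomplex_d (q q' : ℤ) : (singleColumnBicomplex X).d q q' = 0 :=
  single_obj_d _ _ _ _ _

/-- `X[0]` has its columns in (outer) degrees `≥ 0`. [cite: Weibel1994, 1.2.6] -/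
theorem isStrictlyGE_singleColumnBicomplex : CochainComplex.IsStrictlyGE (singleColumnBicomplex X) 0 :=
  (CochainComplex.isStrictlyGE_iff _ _).2 fun q hq => isZero_singleColumnBicomplex_X X q (by omega)

/-- `X[0]` has its columns in (outer) degrees `≤ 0`. [cite: Weibel1994, 1.2.6] -/
theorem isStrictlyLE_singleColumnBicomplex : CochainComplex.IsStrictlyLE (singleColumnBicomplex X) 0 :=
  (CochainComplex.isStrictlyLE_iff _ _).2 fun q hq => isZero_singleColumnBicomplex_X X q (by omega)

/-- Every column of `X[0]` is in degrees `≥ a` when `X` is. [cite: Weibel1994, 1.2.6] -/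
theorem isStrictlyGE_singleColumnBicomplex_X (a : ℤ) [X.IsStrictlyGE a] (q : ℤ) :
    CochainComplex.IsStrictlyGE ((singleColumnBicomplex X).X q) a := by
  by_cases hq : q = 0
  · subst hq
    exact CochainComplex.isStrictlyGE_of_iso (singleColumnBicomplexXZeroIso X).symm a
  · exact (CochainComplex.isStrictlyGE_iff _ _).2 fun n _ => isZero_singleColumnBicomplex_X_X X q hq n

/-- Every column of `X[0]` is in degrees `≤ b` when `X` is. [cite: Weibel1994, 1.2.6] -/
theorem isStrictlyLE_singleColumnBicomplex_X (b : ℤ) [X.IsStrictlyLE b] (q : ℤ) :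
    CochainComplex.IsStrictlyLE ((singleColumnBicomplex X).X q) b := by
  by_cases hq : q = 0
  · subst hq
    exact CochainComplex.isStrictlyLE_of_iso (singleColumnBicomplexXZeroIso X).symm b
  · exact (CochainComplex.isStrictlyLE_iff _ _).2 fun n _ => isZero_singleColumnBicomplex_X_X X q hq n

/-! ### §2 `X ≅ Tot(X[0])` -/

variable [∀ K : HomologicalComplex₂ C (ComplexShape.up ℤ) (ComplexShape.up ℤ), K.HasTotal (ComplexShape.up ℤ)]

/-- The comparison maps `Xⁿ ≅ (X[0])⁰,ⁿ ⟶ Tot(X[0])ⁿ` (the summand `(0, n)`). [cite: Weibel1994, 1.2.6 and Ex. 1.2.8] -/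
def ιTotalSingleColumnF (n : ℤ) : X.X n ⟶ ((singleColumnBicomplex X).total (ComplexShape.up ℤ)).X n :=
  ((singleObjXSelf (ComplexShape.up ℤ) 0 X).inv).f n ≫
    (singleColumnBicomplex X).ιTotal (ComplexShape.up ℤ) 0 n n (zero_add n)

/-- The comparison maps are isomorphisms: all other summands `(X[0])^{q,m}`, `q + m = n`, `q ≠ 0`, of `Tot(X[0])ⁿ` vanish
(`TotalQuasiIsoOfColumns.isIso_ιTotal_of_isZero`). [cite: Weibel1994, 1.2.6 and Ex. 1.2.8] -/
theorem isIso_ιTotalSingleColumnF (n : ℤ) : IsIso (ιTotalSingleColumnF X n) := by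
  haveI := isIso_ιTotal_of_isZero (singleColumnBicomplex X) 0 n n (zero_add n)
    fun j₁ j₂ _ hj₁ => isZero_singleColumnBicomplex_X_X X j₁ hj₁ j₂
  unfold ιTotalSingleColumnF
  infer_instance

/-- The comparison maps commute with the differentials (`ε₂(0, n) = ε(0) = 1`, and the horizontal part vanishes).
[cite: Weibel1994, 1.2.6 and Ex. 1.2.8] [cite: StacksProject, Tag 012Z] -/
theorem ιTotalSingleColumnF_comm (n : ℤ) :
    ιTotalSingleColumnF X n ≫ ((singleColumnBicomplex X).total (ComplexShape.up ℤ)).d n (n + 1) =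
      X.d n (n + 1) ≫ ιTotalSingleColumnF X (n + 1) := by
  simp only [ιTotalSingleColumnF, Category.assoc, HomologicalComplex₂.total_d, Preadditive.comp_add,
    HomologicalComplex₂.ι_D₁, HomologicalComplex₂.ι_D₂]
  rw [HomologicalComplex₂.d₁_eq' _ _ (show (ComplexShape.up ℤ).Rel (0 : ℤ) 1 by simp) n (n + 1), singleColumnBicomplex_d,
    HomologicalComplex.zero_f, zero_comp, smul_zero, comp_zero, zero_add,
    HomologicalComplex₂.d₂_eq _ _ 0 (show (ComplexShape.up ℤ).Rel n (n + 1) by simp) (n + 1) (zero_add _)]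
  change _ ≫ ((((ComplexShape.up ℤ).ε (0 : ℤ)) • _)) = _
  rw [ComplexShape.ε_zero, one_smul, ← Category.assoc, HomologicalComplex.Hom.comm, Category.assoc]

/-- **`X ⟶ Tot(X[0])`**, the comparison chain map. [cite: Weibel1994, 1.2.6 and Ex. 1.2.8] [cite: StacksProject, Tag 012Z] -/
def ιTotalSingleColumn : X ⟶ (singleColumnBicomplex X).total (ComplexShape.up ℤ) where
  f n := ιTotalSingleColumnF X n
  comm' i j hij := by
    obtain rfl : i + 1 = j := hij
    exact ιTotalSingleColumnF_comm X i

/-- The components of `ιTotalSingleColumn` (`rfl`). [cite: Weibel1994, 1.2.6] -/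
@[simp] theorem ιTotalSingleColumn_f (n : ℤ) : (ιTotalSingleColumn X).f n = ιTotalSingleColumnF X n := rfl

/-- **`X ⟶ Tot(X[0])` is an isomorphism.** [cite: Weibel1994, 1.2.6 and Ex. 1.2.8] -/
theorem isIso_ιTotalSingleColumn : IsIso (ιTotalSingleColumn X) := by
  haveI : ∀ n, IsIso ((ιTotalSingleColumn X).f n) := fun n => isIso_ιTotalSingleColumnF X n
  exact Hom.isIso_of_components _

/-- **`X ≅ Tot(X[0])`** as an isomorphism of cochain complexes (`.hom = ιTotalSingleColumn X` by `rfl`).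
[cite: Weibel1994, 1.2.6 and Ex. 1.2.8] [cite: StacksProject, Tag 012Z] -/
def ιTotalSingleColumnIso : X ≅ (singleColumnBicomplex X).total (ComplexShape.up ℤ) :=
  haveI := isIso_ιTotalSingleColumn X
  asIso (ιTotalSingleColumn X)

variable {X} in
/-- Naturality of the comparison maps in `X`, degreewise. [cite: Weibel1994, 1.2.6 and Ex. 1.2.8] -/
theorem ιTotalSingleColumnF_naturality {X' : CochainComplex C ℤ} (ψ : X ⟶ X') (n : ℤ) :
    ιTotalSingleColumnF X n ≫ (HomologicalComplex₂.total.map ((singleColumnFunctor C).map ψ) (ComplexShape.up ℤ)).f n =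
      ψ.f n ≫ ιTotalSingleColumnF X' n := by
  simp only [ιTotalSingleColumnF, Category.assoc, HomologicalComplex₂.ιTotal_map]
  rw [← comp_f_assoc, single_map_f_self, Iso.inv_hom_id_assoc, comp_f_assoc]

variable {X} in
/-- **Naturality of `X ⟶ Tot(X[0])` in `X`.** [cite: Weibel1994, 1.2.6 and Ex. 1.2.8] -/
theorem ιTotalSingleColumn_naturality {X' : CochainComplex C ℤ} (ψ : X ⟶ X') :
    ψ ≫ ιTotalSingleColumn X' =
      ιTotalSingleColumn X ≫ HomologicalComplex₂.total.map ((singleColumnFunctor C).map ψ) (ComplexShape.up ℤ) := by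
  ext n
  rw [comp_f, comp_f, ιTotalSingleColumn_f, ιTotalSingleColumn_f]
  exact (ιTotalSingleColumnF_naturality ψ n).symm

end Literature.Algebra.Homology

end
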